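import Summits.MatrixMultiplication.MatrixMultiplication.Theorems.SoloInformedValFamilyCriterion

/-!
# The difference-set budgets of an accidental-free family of complete blocks

Setting of `SoloInformedValFamilyCriterion`: a finite abelian group `G`, identity potentials, a family
`(X_t × Y_t × Z_t)_{t ∈ T}` of complete blocks with pairwise disjoint `Y`-classes and pairwise disjoint
`Z`-classes, and the FAMILY CRITERION (`noAccidental_family_iff`): accidental-freeness holds iff for every block
`a` the block has the additive TPP and `M_a = X_a + Y_a − Z_a`, `U_a = X_a + ⋃_{b ≠ a} (Y_b − Z_b)`,
`V_a = Y_a + ⋃_{c ≠ a} (X_c − Z_c)` are pairwise disjoint, whence the master inequality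
`|X_a||Y_a||Z_a| + |U_a| + |V_a| ≤ |G|`.

This file makes the master inequality QUANTITATIVE in the sizes of the OTHER blocks:

* `FamilyCriterionAt.disjoint_diffSet_XZ` / `…_YZ`: the `KI`-difference sets `F_c = X_c − Z_c` of distinct
  blocks are pairwise disjoint, and so are the `JK`-difference sets `D_b = Y_b − Z_b` (a common difference would
  put an element of `M_c` into `V_c`, resp. `U_b`);
* `AddTPP.card_diffSet_XZ_eq` / `…_YZ_eq`: under the additive TPP, `|X − Z| = |X||Z|` and `|Y − Z| = |Y||Z|`;
* `card_crossV_ge`, `card_crossU_ge`: `|V_a| ≥ Σ_{c ≠ a} |X_c||Z_c|` and `|U_a| ≥ Σ_{b ≠ a} |Y_b||Z_b|`;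
* `NoAccidental.family_budget_XZ`: `|X_a||Y_a||Z_a| + |U_a| + Σ_{c ≠ a} |X_c||Z_c| ≤ |G|`, and the purely
  numerical consequence `NoAccidental.family_budget`:
  `|X_a||Y_a||Z_a| + Σ_{b ≠ a} |Y_b||Z_b| + Σ_{c ≠ a} |X_c||Z_c| ≤ |G|`;
* `NoAccidental.swapYZ`: accidental-freeness is invariant under exchanging the roles of the `Y`- and
  `Z`-classes, which gives the MIRROR budget `NoAccidental.family_budget_mirror`:
  `|X_a||Y_a||Z_a| + Σ_{b ≠ a} |Y_b||Z_b| + Σ_{c ≠ a} |X_c||Y_c| ≤ |G|`.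

Consequence recorded in the dossier (not formalised here): a hypothetical accidental-free union of complete blocks
violating `T³ ≤ |G|²·I·J·K` needs `|G|` of order `10⁴` at least (e.g. uniform designs with rows shared by three of
six blocks need blocks `10 × 22 × 22` and `8360 ≤ |G| ≤ 8383`).
-/

namespace Summit.MatrixMultiplication.MatrixMultiplication.Theorems.SoloVal

open Finset

section FamilyBudget

variable {G : Type*} [AddCommGroup G] [DecidableEq G]
variable {ι : Type*} [DecidableEq ι]
variable {T : Finset ι} {X Y Z : ι → Finset G} {a : ι}

omit [DecidableEq ι] in
/-- With a nonempty middle class, the additive TPP makes `X − Z` uniquely represented: `|X − Z| = |X||Z|`. -/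
theorem AddTPP.card_diffSet_XZ_eq {X₀ Y₀ Z₀ : Finset G} (h : AddTPP X₀ Y₀ Z₀) (hY : Y₀.Nonempty) :
    (diffSet X₀ Z₀).card = X₀.card * Z₀.card := by
  obtain ⟨y, hy⟩ := hY
  have hinj : Set.InjOn (fun p : G × G => p.1 - p.2) ↑(X₀ ×ˢ Z₀) := by
    rintro ⟨x, z⟩ hm ⟨x', z'⟩ hm' heq
    simp only [Finset.coe_product, Set.mem_prod, Finset.mem_coe] at hm hm'
    have heq' : x - z = x' - z' := heq
    have h0 : (x - y) + (y - z) + (z' - x') = 0 :=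
      calc (x - y) + (y - z) + (z' - x') = (x - z) - (x' - z') := by abel
        _ = 0 := by rw [heq', sub_self]
    obtain ⟨hx, -, hz⟩ := h hm.1 hm'.1 hy hy hm.2 hm'.2 h0
    rw [hx, hz]
  unfold diffSet
  rw [Finset.card_image_of_injOn hinj, Finset.card_product]

omit [DecidableEq ι] in
/-- With a nonempty row class, the additive TPP makes `Y − Z` uniquely represented: `|Y − Z| = |Y||Z|`. -/
theorem AddTPP.card_diffSet_YZ_eq {X₀ Y₀ Z₀ : Finset G} (h : AddTPP X₀ Y₀ Z₀) (hX : X₀.Nonempty) :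
    (diffSet Y₀ Z₀).card = Y₀.card * Z₀.card := by
  obtain ⟨x, hx⟩ := hX
  have hinj : Set.InjOn (fun p : G × G => p.1 - p.2) ↑(Y₀ ×ˢ Z₀) := by
    rintro ⟨y, z⟩ hm ⟨y', z'⟩ hm' heq
    simp only [Finset.coe_product, Set.mem_prod, Finset.mem_coe] at hm hm'
    have heq' : y - z = y' - z' := heq
    have h0 : (x - y') + (y - z) + (z' - x) = 0 :=
      calc (x - y') + (y - z) + (z' - x) = (y - z) - (y' - z') := by abel
        _ = 0 := by rw [heq', sub_self]
    obtain ⟨-, hy, hz⟩ := h hx hx hm'.1 hm.1 hm.2 hm'.2 h0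
    rw [← hy, hz]
  unfold diffSet
  rw [Finset.card_image_of_injOn hinj, Finset.card_product]

/-- Under the family criterion at `c` (with `Y_c` nonempty), the `KI`-difference set `X_c − Z_c` is disjoint from
`X_d − Z_d` for every other block `d` of the family: a common difference `x − z = x' − z'` would put
`x + y − z = y + (x' − z')` into `M_c ∩ V_c`. -/
theorem FamilyCriterionAt.disjoint_diffSet_XZ {c d : ι} (h : FamilyCriterionAt T X Y Z c)
    (hY : (Y c).Nonempty) (hd : d ∈ T) (hcd : c ≠ d) :
    Disjoint (diffSet (X c) (Z c)) (diffSet (X d) (Z d)) := by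
  obtain ⟨y, hy⟩ := hY
  obtain ⟨-, -, hMV, -⟩ := h
  rw [Finset.disjoint_left] at hMV ⊢
  intro f hf hf'
  obtain ⟨x, hx, z, hz, rfl⟩ := mem_diffSet.mp hf
  obtain ⟨x', hx', z', hz', heq⟩ := mem_diffSet.mp hf'
  have hM : x + y - z ∈ mixedImage (X c) (Y c) (Z c) := mem_mixedImage.mpr ⟨x, hx, y, hy, z, hz, rfl⟩
  have hV : x + y - z ∈ crossV T X Y Z c :=
    mem_crossV.mpr ⟨y, hy, d, Finset.mem_erase.mpr ⟨hcd.symm, hd⟩, x', hx', z', hz', by rw [heq]; abel⟩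
  exact hMV hM hV

/-- Under the family criterion at `b` (with `X_b` nonempty), the `JK`-difference set `Y_b − Z_b` is disjoint from
`Y_d − Z_d` for every other block `d`: a common difference would put `x + y − z = x + (y' − z')` into
`M_b ∩ U_b`. -/
theorem FamilyCriterionAt.disjoint_diffSet_YZ {b d : ι} (h : FamilyCriterionAt T X Y Z b)
    (hX : (X b).Nonempty) (hd : d ∈ T) (hbd : b ≠ d) :
    Disjoint (diffSet (Y b) (Z b)) (diffSet (Y d) (Z d)) := by
  obtain ⟨x, hx⟩ := hX
  obtain ⟨-, hMU, -, -⟩ := h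
  rw [Finset.disjoint_left] at hMU ⊢
  intro f hf hf'
  obtain ⟨y, hy, z, hz, rfl⟩ := mem_diffSet.mp hf
  obtain ⟨y', hy', z', hz', heq⟩ := mem_diffSet.mp hf'
  have hM : x + y - z ∈ mixedImage (X b) (Y b) (Z b) := mem_mixedImage.mpr ⟨x, hx, y, hy, z, hz, rfl⟩
  have hU : x + y - z ∈ crossU T X Y Z b :=
    mem_crossU.mpr ⟨x, hx, d, Finset.mem_erase.mpr ⟨hbd.symm, hd⟩, y', hy', z', hz', by rw [heq]; abel⟩
  exact hMU hM hU

/-- `V_a` contains a translate of the union of the other blocks' `KI`-difference sets. -/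
theorem card_biUnion_diffSet_XZ_le_card_crossV (hY : (Y a).Nonempty) :
    ((T.erase a).biUnion fun c => diffSet (X c) (Z c)).card ≤ (crossV T X Y Z a).card := by
  obtain ⟨y, hy⟩ := hY
  calc ((T.erase a).biUnion fun c => diffSet (X c) (Z c)).card
      = (((T.erase a).biUnion fun c => diffSet (X c) (Z c)).image fun f => y + f).card := by
        rw [Finset.card_image_of_injective _ (add_right_injective y)]
    _ ≤ (crossV T X Y Z a).card := by
        apply Finset.card_le_card
        intro g hg
        obtain ⟨f, hf, rfl⟩ := Finset.mem_image.mp hg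
        unfold crossV sumSet
        exact Finset.mem_image.mpr ⟨(y, f), Finset.mem_product.mpr ⟨hy, hf⟩, rfl⟩

/-- `U_a` contains a translate of the union of the other blocks' `JK`-difference sets. -/
theorem card_biUnion_diffSet_YZ_le_card_crossU (hX : (X a).Nonempty) :
    ((T.erase a).biUnion fun b => diffSet (Y b) (Z b)).card ≤ (crossU T X Y Z a).card := by
  obtain ⟨x, hx⟩ := hX
  calc ((T.erase a).biUnion fun b => diffSet (Y b) (Z b)).card
      = (((T.erase a).biUnion fun b => diffSet (Y b) (Z b)).image fun d => x + d).card := by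
        rw [Finset.card_image_of_injective _ (add_right_injective x)]
    _ ≤ (crossU T X Y Z a).card := by
        apply Finset.card_le_card
        intro g hg
        obtain ⟨d, hd, rfl⟩ := Finset.mem_image.mp hg
        unfold crossU sumSet
        exact Finset.mem_image.mpr ⟨(x, d), Finset.mem_product.mpr ⟨hx, hd⟩, rfl⟩

/-- THE `KI`-BUDGET: under the family criterion at every block (all `Y`-classes nonempty),
`Σ_{c ≠ a} |X_c||Z_c| ≤ |V_a|`. -/
theorem card_crossV_ge (h : ∀ c ∈ T, FamilyCriterionAt T X Y Z c) (hYne : ∀ c ∈ T, (Y c).Nonempty)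
    (ha : a ∈ T) :
    ∑ c ∈ T.erase a, (X c).card * (Z c).card ≤ (crossV T X Y Z a).card := by
  have hdisj : ((T.erase a : Finset ι) : Set ι).PairwiseDisjoint fun c => diffSet (X c) (Z c) := by
    intro c hc d hd hcd
    have hc' : c ∈ T := Finset.mem_of_mem_erase (Finset.mem_coe.mp hc)
    have hd' : d ∈ T := Finset.mem_of_mem_erase (Finset.mem_coe.mp hd)
    exact (h c hc').disjoint_diffSet_XZ (hYne c hc') hd' hcd
  calc ∑ c ∈ T.erase a, (X c).card * (Z c).card
      = ∑ c ∈ T.erase a, (diffSet (X c) (Z c)).card := by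
        refine Finset.sum_congr rfl fun c hc => ?_
        rw [(h c (Finset.mem_of_mem_erase hc)).1.card_diffSet_XZ_eq (hYne c (Finset.mem_of_mem_erase hc))]
    _ = ((T.erase a).biUnion fun c => diffSet (X c) (Z c)).card := (Finset.card_biUnion hdisj).symm
    _ ≤ (crossV T X Y Z a).card := card_biUnion_diffSet_XZ_le_card_crossV (hYne a ha)

/-- THE `JK`-BUDGET: under the family criterion at every block (all `X`-classes nonempty),
`Σ_{b ≠ a} |Y_b||Z_b| ≤ |U_a|`. -/
theorem card_crossU_ge (h : ∀ c ∈ T, FamilyCriterionAt T X Y Z c) (hXne : ∀ c ∈ T, (X c).Nonempty)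
    (ha : a ∈ T) :
    ∑ b ∈ T.erase a, (Y b).card * (Z b).card ≤ (crossU T X Y Z a).card := by
  have hdisj : ((T.erase a : Finset ι) : Set ι).PairwiseDisjoint fun b => diffSet (Y b) (Z b) := by
    intro c hc d hd hcd
    have hc' : c ∈ T := Finset.mem_of_mem_erase (Finset.mem_coe.mp hc)
    have hd' : d ∈ T := Finset.mem_of_mem_erase (Finset.mem_coe.mp hd)
    exact (h c hc').disjoint_diffSet_YZ (hXne c hc') hd' hcd
  calc ∑ b ∈ T.erase a, (Y b).card * (Z b).card
      = ∑ b ∈ T.erase a, (diffSet (Y b) (Z b)).card := by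
        refine Finset.sum_congr rfl fun b hb => ?_
        rw [(h b (Finset.mem_of_mem_erase hb)).1.card_diffSet_YZ_eq (hXne b (Finset.mem_of_mem_erase hb))]
    _ = ((T.erase a).biUnion fun b => diffSet (Y b) (Z b)).card := (Finset.card_biUnion hdisj).symm
    _ ≤ (crossU T X Y Z a).card := card_biUnion_diffSet_YZ_le_card_crossU (hXne a ha)

/-- THE STRENGTHENED MASTER INEQUALITY (criterion form): `|X_a||Y_a||Z_a| + |U_a| + Σ_{c ≠ a} |X_c||Z_c| ≤ |G|`. -/
theorem familyCriterion_budget_XZ [Fintype G] (h : ∀ c ∈ T, FamilyCriterionAt T X Y Z c)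
    (hYne : ∀ c ∈ T, (Y c).Nonempty) (ha : a ∈ T) :
    (X a).card * (Y a).card * (Z a).card + (crossU T X Y Z a).card +
        ∑ c ∈ T.erase a, (X c).card * (Z c).card ≤ Fintype.card G :=
  le_trans (Nat.add_le_add_left (card_crossV_ge h hYne ha) _)
    (h a ha).volume_add_card_crossU_add_card_crossV_le

/-- THE NUMERICAL BUDGET (criterion form):
`|X_a||Y_a||Z_a| + Σ_{b ≠ a} |Y_b||Z_b| + Σ_{c ≠ a} |X_c||Z_c| ≤ |G|`. -/
theorem familyCriterion_budget [Fintype G] (h : ∀ c ∈ T, FamilyCriterionAt T X Y Z c)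
    (hXne : ∀ c ∈ T, (X c).Nonempty) (hYne : ∀ c ∈ T, (Y c).Nonempty) (ha : a ∈ T) :
    (X a).card * (Y a).card * (Z a).card + ∑ b ∈ T.erase a, (Y b).card * (Z b).card +
        ∑ c ∈ T.erase a, (X c).card * (Z c).card ≤ Fintype.card G := by
  have h₁ := familyCriterion_budget_XZ h hYne ha
  have h₂ := card_crossU_ge h hXne ha
  omega

/-- The strengthened master inequality for an accidental-free family with pairwise disjoint `Y`- and `Z`-classes:
`|X_a||Y_a||Z_a| + |U_a| + Σ_{c ≠ a} |X_c||Z_c| ≤ |G|`. -/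
theorem NoAccidental.family_budget_XZ [Fintype G]
    (hY : ∀ a ∈ T, ∀ b ∈ T, a ≠ b → Disjoint (Y a) (Y b))
    (hZ : ∀ a ∈ T, ∀ b ∈ T, a ≠ b → Disjoint (Z a) (Z b))
    (hYne : ∀ c ∈ T, (Y c).Nonempty)
    (hN : NoAccidental (id : G → G) id id (famPairs T X Y) (famPairs T Y Z) (famPairs T Z X))
    (ha : a ∈ T) :
    (X a).card * (Y a).card * (Z a).card + (crossU T X Y Z a).card +
        ∑ c ∈ T.erase a, (X c).card * (Z c).card ≤ Fintype.card G :=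
  familyCriterion_budget_XZ (fun _ hc => familyCriterion_of_noAccidental hY hZ hN hc) hYne ha

/-- THE BUDGET of an accidental-free family with pairwise disjoint `Y`- and `Z`-classes and nonempty classes:
`|X_a||Y_a||Z_a| + Σ_{b ≠ a} |Y_b||Z_b| + Σ_{c ≠ a} |X_c||Z_c| ≤ |G|` for every block `a`. -/
theorem NoAccidental.family_budget [Fintype G]
    (hY : ∀ a ∈ T, ∀ b ∈ T, a ≠ b → Disjoint (Y a) (Y b))
    (hZ : ∀ a ∈ T, ∀ b ∈ T, a ≠ b → Disjoint (Z a) (Z b))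
    (hXne : ∀ c ∈ T, (X c).Nonempty) (hYne : ∀ c ∈ T, (Y c).Nonempty)
    (hN : NoAccidental (id : G → G) id id (famPairs T X Y) (famPairs T Y Z) (famPairs T Z X))
    (ha : a ∈ T) :
    (X a).card * (Y a).card * (Z a).card + ∑ b ∈ T.erase a, (Y b).card * (Z b).card +
        ∑ c ∈ T.erase a, (X c).card * (Z c).card ≤ Fintype.card G :=
  familyCriterion_budget (fun _ hc => familyCriterion_of_noAccidental hY hZ hN hc) hXne hYne ha

omit [DecidableEq ι] in
/-- MIRROR SYMMETRY: accidental-freeness of a family of complete blocks is invariant under exchanging the roles of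
the `Y`- and `Z`-classes (negate the hexagon relation and read it backwards). -/
theorem NoAccidental.swapYZ
    (hN : NoAccidental (id : G → G) id id (famPairs T X Y) (famPairs T Y Z) (famPairs T Z X)) :
    NoAccidental (id : G → G) id id (famPairs T X Z) (famPairs T Z Y) (famPairs T Y X) := by
  intro i j j' k k' i' hIJ hJK hKI h0
  obtain ⟨t, ht, hi, hj⟩ := mem_famPairs.mp hIJ
  obtain ⟨b, hb, hj', hk⟩ := mem_famPairs.mp hJK
  obtain ⟨c, hc, hk', hi'⟩ := mem_famPairs.mp hKI
  have h0' : (id i' - id k') + (id k - id j') + (id j - id i) = (0 : G) := by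
    have : (id i' - id k') + (id k - id j') + (id j - id i) =
        -((id i - id j) + (id j' - id k) + (id k' - id i') : G) := by
      simp only [id]; abel
    rw [this, h0, neg_zero]
  obtain ⟨h₁, h₂, h₃⟩ := hN i' k' k j' j i (mem_famPairs.mpr ⟨c, hc, hi', hk'⟩)
    (mem_famPairs.mpr ⟨b, hb, hk, hj'⟩) (mem_famPairs.mpr ⟨t, ht, hj, hi⟩) h0'
  exact ⟨h₁.symm, h₃.symm, h₂.symm⟩

/-- THE MIRROR BUDGET: `|X_a||Y_a||Z_a| + Σ_{b ≠ a} |Y_b||Z_b| + Σ_{c ≠ a} |X_c||Y_c| ≤ |G|` for every block of an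
accidental-free family with pairwise disjoint, nonempty `Y`- and `Z`-classes and nonempty row classes. -/
theorem NoAccidental.family_budget_mirror [Fintype G]
    (hY : ∀ a ∈ T, ∀ b ∈ T, a ≠ b → Disjoint (Y a) (Y b))
    (hZ : ∀ a ∈ T, ∀ b ∈ T, a ≠ b → Disjoint (Z a) (Z b))
    (hXne : ∀ c ∈ T, (X c).Nonempty) (hZne : ∀ c ∈ T, (Z c).Nonempty)
    (hN : NoAccidental (id : G → G) id id (famPairs T X Y) (famPairs T Y Z) (famPairs T Z X))
    (ha : a ∈ T) :
    (X a).card * (Y a).card * (Z a).card + ∑ b ∈ T.erase a, (Y b).card * (Z b).card +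
        ∑ c ∈ T.erase a, (X c).card * (Y c).card ≤ Fintype.card G := by
  have h := NoAccidental.family_budget (X := X) (Y := Z) (Z := Y) hZ hY hXne hZne
    (NoAccidental.swapYZ hN) ha
  have e₁ : (X a).card * (Z a).card * (Y a).card = (X a).card * (Y a).card * (Z a).card := by ring
  have e₂ : ∑ b ∈ T.erase a, (Z b).card * (Y b).card = ∑ b ∈ T.erase a, (Y b).card * (Z b).card :=
    Finset.sum_congr rfl fun b _ => Nat.mul_comm _ _
  rw [e₁, e₂] at h
  exact h

end FamilyBudget

end Summit.MatrixMultiplication.MatrixMultiplication.Theorems.SoloVal
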